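import HarnessLib
import Summits.HodgeConjecture.HodgeConjecture.Cruxes.H413.Lines.K2_E3_EllipticInputs   -- tier 0: the seven stubs + `ellipticInputs_of_line` (namespace ∕ opens of record; Lines→Lines import, statements only)
import Summits.HodgeConjecture.HodgeConjecture.Theorems.K2E3CharLocIntNearSemisimpleNonsplitTwoOfQuasiSplitIdentity   -- ★ p860510 (K2E3-p27 g0) D111 reduction: `charLocIntNearSemisimple_nonsplitTwo_of_cmQsIdentity` — its `hqs₂` antecedent IS the (11-2qs-Id′) currency (organ carrier `U(Φ₂)(L⁺_v)`)
import Summits.HodgeConjecture.HodgeConjecture.Theorems.K2E3LocalIrrepCuspidalOrPrincipalTwo   -- ★ p860637 (K2E3-p27 g0) (qs2-cls) `irrClass_isSupercuspidal_or_isConstituentOf_cmPrincipalSeries_two`, `isSmooth_cmPrincipalSeries` — the BY-CLASS dispatch of (11-2qs-Id′)   [ED. 2]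
import Literature.NumberTheory.Automorphic.SmoothCharacter                                 -- ★ `IrrClass.smoothTrace`, `SchwartzBruhat` (explicit; also transitive)   [ED. 2]
import Summits.HodgeConjecture.HodgeConjecture.Cruxes.H413.Lines.K2_E3_EllipticInputsSigs_U12CharactersSC     -- PART «SC»: (SC-an) `sig_K2E3SupercuspidalTruncatedCharAnalytic` (general N)   [ED. 3]
import Summits.HodgeConjecture.HodgeConjecture.Theorems.K2E3CharLocIntNearIdentitySupercuspidalTwoOfSCan   -- ★ p860866 (K2E3-p27 g0) HEAD 1 `charLocIntNearIdentity_supercuspidal_two_of_sigSCan` : (SC-an) → (qs2-sc)   [ED. 3]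
import Summits.HodgeConjecture.HodgeConjecture.Theorems.K2E3CharLocIntNearIdentityResidualQuasiSplitTwoOfCut   -- ★ p860946 (K2E3-p26 g0) D127 `charLocIntNearIdentityResidual_of_cut (hrep) (hω)` : (qs2-res)   [ED. 5]
import Summits.HodgeConjecture.HodgeConjecture.Theorems.K2E3CharLocIntNearPrincipalSeriesQuasiSplitTwo        -- ★ p861123 (K2E3-p21 g8) (ASM₂) B2: §3 pays (qs2-ps) VERBATIM, §2 pays (ps-rep)   [ED. 6]
import Summits.HodgeConjecture.HodgeConjecture.Cruxes.H413.Lines.K2_E3_EllipticInputsSigs_U12CharactersRankCI     -- PART «RankCI» (K2E3-typ3 g0, D169): the letter socket (res-ω-CI) `sig_K2E3OmegaQuasiSplitTwoU2CharIdentity`   [ED. 7]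
import Summits.HodgeConjecture.HodgeConjecture.Theorems.K2E3CharLocIntNearIdentityOmegaQuasiSplitTwoOfU2CharIdentity   -- ★ D142 p861578 (K2E3-p21 g8) NR-3: (res-ω) ⟸ (res-ω-CI) `omegaQuasiSplitTwo_of_u2CharIdentity`   [ED. 7]

/-!
# K2_E3_EllipticInputs ∕ U12Characters — PART «RANK» (ED. 1; byte-cap companion of `Lines/K2_E3_EllipticInputsSigs_U12Characters.lean` exactly like PART «LIE» (ED. 23):
SAME namespace `Summit.HodgeConjecture.HodgeConjecture.Cruxes.H413.K2E3EllipticInputs.U12Characters`, every FQ name as if hosted in the main module; the HEADER OF RECORD, the editions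
log, the accounting and the tier-0 compositions stay in the main module, which imports this one from its ED. 34 on).

CONTENT.  The SUB-SOCKETS of U12 MAIN §11-RANK (the by-rank re-cut of (11-N≠3), ruling R33 (B) ∕ R35, MAIN ED. 32) that are hosted AFTER the main module reached the 200 000-byte
workfile cap region — statements delivered by the census seats, hosted VERBATIM, FROZEN from their hosting edition; payers conclude them BY NAME from `Theorems/…` and never import `Lines`.

* §R2ns (ED. 1) **(11-2qs-Id′) `sig_K2E3CharLocIntNearIdentityQuasiSplitTwo`** — K2E3-p27 (g0) CENSUS D111 `K2/K2E3-p27/g0/CENSUS-NonsplitTwo.K2E3-p27-g0.md` fbfa3ad8dfcd8e03 + cand v2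
  `recut_112nonsplit.cand.v2.K2E3-p27-g0.lean` 2793221d82cab1ea (leaf text `subsocket_11-2qs-Id-prime.text.txt` b07cb765566c4669, bytes VERBATIM; K2E3-r01 (g4) PRE-BOX PASS 13:18:27Z on
  text + kernel composability, v2 preferred by census author and second reader): «Harish-Chandra's theorem AT THE IDENTITY for the quasi-split `U(Φ₂)(L⁺_v) = U(1,1)(L⁺_v)` on the ORGAN's
  semi-local carrier `↥(unitaryGroupOfForm (conjLocal L c v) (cmLocalForm L 2 v))` (home of ★ `cmPrincipalSeries L 2 v`, ★ `cmBorelTriple L 2 v`, ★ HC₂), every irreducible smooth class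
  (admissibility is ★ p857017, so no antecedent), `v` non-split» — the single antecedent `hqs₂` of ★ p860510
  `K2E3CharLocIntNearSemisimpleNonsplitTwoOfQuasiSplitIdentity.charLocIntNearSemisimple_nonsplitTwo_of_cmQsIdentity : ‹(11-2qs-Id′)› → ‹(11-2-nonsplit) VERBATIM›` (anisotropic `H_w` ★ p855012
  by application; isotropic `H_w` ⇒ ★ `localNonsplitEquiv` model transport + central translate ★ p855802 + row 9 ★), by which the MAIN socket (11-2-nonsplit)
  `sig_K2E3CharLocIntNearSemisimpleNonsplitTwo` becomes REL over EXACTLY {(11-2qs-Id′)} from MAIN ED. 35.  OPEN (L–XL: roads (qs2-cls) Jacquet₂ ∕ (qs2-ps) van Dijk₂ port — D114 K2E3-p21 (g7),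
  whose `G₂` head docks on this carrier with no transport — ∕ (qs2-res) ∕ (qs2-sc) = the N = 2 supercuspidal corner, honest XL-adjacent; census §3).

* §R2qs (ED. 2) THE THREE LEAVES OF (11-2qs-Id′) BY CLASS (K2E3-p27 (g0) cand `K2/K2E3-p27/g0/tie_qs2Id.cand.v1.K2E3-p27-g0.lean`, blocks VERBATIM; combined farm probe
  `Probe_tie_qs2Id_combined.K2E3-p27-g0.lean` 13a90bb98950f5b4 rc 0 ∕ s3 ∕ tie TRIO+sorryAx via the leaves only): **(qs2-ps) `sig_K2E3CharLocIntNearPrincipalSeriesQuasiSplitTwo`** (= K2E3-p21 (g7)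
  D114 head probe `K2/K2E3-p21/g7/QS2PS_head.probe.K2E3-p21-g7.lean` 30211bd0e0dc6d8c VERBATIM; every `s`; cut (TOR₂-Defs) D115 K2E3-p26 ∕ (VDW₂) D116 K2E3-p11 ∕ (HCD₂) D117 K2E3-p27 ∕
  (WEYL₂) D118 K2E3-p14 ∕ (CLS₂-fun) D119 architect K2E3-p25 ∕ (ASM₂)+head K2E3-p21 lineage), **(qs2-sc) `sig_K2E3CharLocIntNearIdentitySupercuspidalQuasiSplitTwo`** (HC 1970 VII «FC₂»; honest
  XL-adjacent corner), **(qs2-res) `sig_K2E3CharLocIntNearIdentityResidualQuasiSplitTwo`** (reducible `i_G(χ)` constituents; L); and (11-2qs-Id′) becomes **REL-TIED** over EXACTLY these three by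
  the cand's dispatch proof (supercuspidal ∕ irreducible `i_G(χ)` at `s := 1` ∕ reducible), statement FROZEN from ED. 1.

* PART «RankCI» (ED. 7, imported) **(res-ω-CI) `sig_K2E3OmegaQuasiSplitTwoU2CharIdentity`** — the letter of ★ D142 (K2E3-p21 (g8) v2 8eb68838a107f36b), hosted in `Lines/K2_E3_EllipticInputsSigs_U12CharactersRankCI.lean`
  (K2E3-typ3 g0, D169 shape (B)); (res-ω) REL-TIED over EXACTLY {(res-ω-CI)} from ED. 7.

Sorries in THIS file = 0 (ED. 7: (res-ω) REL-TIED over the PART «RankCI» letter (res-ω-CI) by ★ D142 p861578 — the sorry MOVED to RankCI, none paid; ED. 6 had 1 = {(res-ω)}: (qs2-ps) and (ps-rep) ★-tied by ★ p861123; ED. 5 had 3 = {(qs2-ps), (ps-rep), (res-ω)}: (qs2-res) ★-tied over {(ps-rep), (res-ω)} by ★ p860946, + leaf (ps-rep); ED. 4: + (res-ω), (qs2-sc) over (SC-an)₂; ED. 2 had 3; ED. 1 had 1).  E3 Lines census: +1 here, −0 in MAIN until the (11-2-nonsplit) tie lands (then MAIN −1): net 0 — a finer leaf, not a regress (same token as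 ED. 32).

§ EDITIONS (this PART).  ED. 1 (K2E3-plan g4, 2026-09-04 13:22Z, d50b2a21023a ∕ a4c64ba931f828b3): created; hosts (11-2qs-Id′) only (generator `mk_u12rank_ed1.py`).  ED. 2 (K2E3-plan g4,
≈13:45Z; generator `mk_u12rank_ed2.py`, base a4c64ba931f828b3): + §R2qs three leaves VERBATIM from K2E3-p27 (g0)'s cand, (11-2qs-Id′) REL-TIED by class over them (+2 imports); the ED. 1
statement byte-identical (script-asserted).  ED. 3 (K2E3-plan g4, generator `mk_sc_move.py`, base 7e1e534857a4cd8b): +2 imports (PART «SC», ★ p860866) and (qs2-sc)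
:= ★ HEAD 1 applied to (SC-an) BY NAME; every statement byte-identical (script-asserted).  ED. 4 (K2E3-plan g4, generator `mk_sc_ed2_rank_ed4.py`, base 8a5cf6fb54f8c445):
(qs2-sc) RE-POINTED to HEAD 2 over the instance leaf (SC-an)₂ (architect (R5)); + §R2ω leaf (res-ω) `sig_K2E3CharLocIntNearIdentityOmegaQuasiSplitTwo` (K2E3-p26 text, architect «=», R37); statements frozen.  ED. 5 (K2E3-plan g4, generator `mk_u12rank_ed5.py`, base 7be5b05bdda79f02): + §R2rep leaf (ps-rep)
`sig_K2E3CharLocIntNearCmPrincipalSeriesQuasiSplitTwo` (= `hrep` of ★ p860946 verbatim); (qs2-res) TIED := ★ p860946 `(ps-rep) (res-ω)`; (qs2-res) block moved below §R2ω∕§R2rep (declaration order); statements frozen.  ED. 6 (K2E3-plan g4, generator `mk_u12rank_ed6.py`, base 0ce2a5af70be374d): (qs2-ps) ★-TIED := ★ p861123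
`K2E3CharLocIntNearPrincipalSeriesQuasiSplitTwo.charLocIntNearPrincipalSeries_quasiSplitTwo` (VERBATIM); (ps-rep) ★-TIED := ★ p861123 §2 by binder adapter; + 1 import; sorries 3 → 1 = {(res-ω)}; every statement byte-identical (script-asserted).  ED. 7 (K2E3-typ3 g0, generator `K2/K2E3-typ3/g0/mk_rankci_ed1.py`, base fa7bd0279a8b775a; dealer D169 16:08:51Z shape (B)): + 2 imports (PART «RankCI», ★ D142 p861578); (res-ω) REL-TIED := ★ D142 `K2E3CharLocIntNearIdentityOmegaQuasiSplitTwoOfU2CharIdentity.omegaQuasiSplitTwo_of_u2CharIdentity sig_K2E3OmegaQuasiSplitTwoU2CharIdentity` over the RankCI socket; NO statement added here; sorries 1 → 0 (moved to RankCI); every statement byte-identical (script-asserted).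

HONEST LABEL: HC_CM is proved only modulo the 7 printed citations (2 remaining named inputs: hLiu418 = stmt-HodgeConjecture-24832, h413 = stmt-HodgeConjecture-24833) until rung 0 closes; REL ≠ ★. -/

noncomputable section

open NumberField IsDedekindDomain MeasureTheory
open scoped Matrix MatrixGroups Valued NNReal
open Literature.NumberTheory.Rogawski1990 Literature.NumberTheory.Automorphic Literature.NumberTheory.Automorphic.UnitaryGroup
open Literature.NumberTheory.Automorphic.UnitaryGroup.CotangentForms Literature.NumberTheory.GaloisRepresentations
open Literature.NumberTheory.Automorphic.Arthur2013.Leaves.TECR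
open Summit.HodgeConjecture.HodgeConjecture.Cruxes.H413.F0P3cStCharTSPaydown

namespace Summit.HodgeConjecture.HodgeConjecture.Cruxes.H413.K2E3EllipticInputs.U12Characters

/-! ## §R2qs (ED. 2) — the three leaves of (11-2qs-Id′) BY CLASS on `G₂ = U(Φ₂)(L⁺_v)` (K2E3-p27 (g0) cand `tie_qs2Id.cand.v1`; (qs2-ps) bytes = K2E3-p21 (g7) D114 head probe) -/

set_option maxHeartbeats 1600000 in
set_option synthInstance.maxHeartbeats 400000 in
/-- **LEAF (qs2-ps)** (ED. 6: **★-TIED BY NAME** := ★ p861123 `K2E3CharLocIntNearPrincipalSeriesQuasiSplitTwo.charLocIntNearPrincipalSeries_quasiSplitTwo` — K2E3-p21 (g8) (ASM₂) FILE B2, statement VERBATIM; over ★ A1 p860903 · A2 p860934 · B1 p860986 · D115 p860691 · D116 p860845 · D117 p860826 · D118 p860713∕p860822∕p860877 · D119 p860719; statement FROZEN) — ROW 11 FOR THE CLASSES OF `U(Φ₂)(L⁺_v)` EQUIVALENT TO A PRINCIPAL SERIES `i_G(χ)` (`χ` a continuous character of the diagonal torus `T₂ ≅ L_w^×`), `v`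 non-split,
at EVERY point `s`: van Dijk's induced-character formula on the hyperbolic set + Weyl integration + `|D_{U(1,1)}|^{-1∕2} ∈ L¹_loc` (census K2E3-p21 (g7) D114 2026-09-04T13:14Z: bricks
(VDW₂)∕(WEYL₂)∕(HCD₂)∕(CLS₂-fun)∕(ASM₂), N = 2 twins of the ★ (11-PS) road at N = 3).  Bytes = K2E3-p21 (g7) probe `QS2PS_head.probe.K2E3-p21-g7.lean` VERBATIM.  Size: L.  STATE: ★-tied (ED. 6; was OPEN).
[cite: vanDijk1972, Thm. p. 237] [cite: HarishChandra1970, Part V Thm. 15 p. 63] [cite: Rogawski1990, §12.1 p. 171] -/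
theorem sig_K2E3CharLocIntNearPrincipalSeriesQuasiSplitTwo :
  ∀ (L : Type) [Field L] [NumberField L] [IsCMField L] (v : HeightOneSpectrum (𝓞 ↥(maximalRealSubfield L))),
    (∀ w : PlacesOver L v, IsCMField.complexConj L • w.1 = w.1) →
    ∀ [MeasurableSpace ↥(unitaryGroupOfForm (conjLocal L (IsCMField.complexConj L) v) (cmLocalForm L 2 v))]
      [BorelSpace ↥(unitaryGroupOfForm (conjLocal L (IsCMField.complexConj L) v) (cmLocalForm L 2 v))]
      (μ : Measure ↥(unitaryGroupOfForm (conjLocal L (IsCMField.complexConj L) v) (cmLocalForm L 2 v))) [μ.IsHaarMeasure]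
      (χ : ↥(cmBorelTriple L 2 v).M →* ℂˣ), Continuous (fun t => ((χ t : ℂˣ) : ℂ)) →
      ∀ (c : IrrClass ↥(unitaryGroupOfForm (conjLocal L (IsCMField.complexConj L) v) (cmLocalForm L 2 v)))
        (r : SmoothIrrep ↥(unitaryGroupOfForm (conjLocal L (IsCMField.complexConj L) v) (cmLocalForm L 2 v))),
        IrrClass.mk r = c → Nonempty (r.ρ.Equiv (UnitaryGroup.cmPrincipalSeries L 2 v χ)) →
      ∀ s : ↥(unitaryGroupOfForm (conjLocal L (IsCMField.complexConj L) v) (cmLocalForm L 2 v)),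
        ∃ U : Set ↥(unitaryGroupOfForm (conjLocal L (IsCMField.complexConj L) v) (cmLocalForm L 2 v)), IsOpen U ∧ s ∈ U ∧
          ∃ Θ : ↥(unitaryGroupOfForm (conjLocal L (IsCMField.complexConj L) v) (cmLocalForm L 2 v)) → ℂ, IntegrableOn Θ U μ ∧
            ∀ f : ↥(unitaryGroupOfForm (conjLocal L (IsCMField.complexConj L) v) (cmLocalForm L 2 v)) → ℂ,
              f ∈ SchwartzBruhat ↥(unitaryGroupOfForm (conjLocal L (IsCMField.complexConj L) v) (cmLocalForm L 2 v)) → tsupport f ⊆ U →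
              c.smoothTrace μ f = ∫ g, f g * Θ g ∂μ :=
  K2E3CharLocIntNearPrincipalSeriesQuasiSplitTwo.charLocIntNearPrincipalSeries_quasiSplitTwo

set_option maxHeartbeats 1600000 in
set_option synthInstance.maxHeartbeats 400000 in
/-- **LEAF (qs2-sc)** (ED. 4: **★-TIED BY NAME over (SC-an)₂** := ★ p860866 HEAD 2 `K2E3CharLocIntNearIdentitySupercuspidalTwoOfSCan.charLocIntNearIdentity_supercuspidal_two_of_sigSCanTwo sig_K2E3SupercuspidalTruncatedCharAnalyticTwo` — architect (R5): REL over EXACTLY {(SC-an)₂} of PART «SC» (the FC₂-payable instance); ED. 3 tied it over the ∀-N (SC-an) via HEAD 1; statement FROZEN; ED. 2: OPEN) — HARISH-CHANDRA'S THEOREM AT THE IDENTITY FOR THE SUPERCUSPIDAL CLASSES OF `U(Φ₂)(L⁺_v)`, `v` non-split: for every Haar `μ` and every supercuspidal class `c`,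
`χ_c` is an integrable function near `1` (Harish-Chandra 1970 Part VII §3 Thm 16 for the rank-one `U(1,1)`: truncated orbital integrals of a cusp form, Thms 14, 18–20, `|D|^{-1∕2} ∈ L¹_loc`
Thm 15; road = the `Fin 2` twin «FC₂» of ★ FC-8∕FC-9∕D56, or the general-`N` (SC-an) letter :324 at N = 2 through ★ p856184 + transport).  Size: L–XL.  STATE: OPEN.
[cite: HarishChandra1970, Part VII §3 Thm. 16 p. 67; Thms 14–15, 18–20] [cite: HarishChandra1999, Thm. 16.1 p. 77] [cite: Rogawski1990, §12.2 p. 173] -/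
theorem sig_K2E3CharLocIntNearIdentitySupercuspidalQuasiSplitTwo :
  ∀ (L : Type) [Field L] [NumberField L] [IsCMField L] (v : HeightOneSpectrum (𝓞 ↥(maximalRealSubfield L))),
      (∀ w : PlacesOver L v, IsCMField.complexConj L • w.1 = w.1) →
      ∀ [MeasurableSpace ↥(unitaryGroupOfForm (conjLocal L (IsCMField.complexConj L) v) (cmLocalForm L 2 v))] [BorelSpace ↥(unitaryGroupOfForm (conjLocal L (IsCMField.complexConj L) v) (cmLocalForm L 2 v))]
        (μ : Measure ↥(unitaryGroupOfForm (conjLocal L (IsCMField.complexConj L) v) (cmLocalForm L 2 v))) [μ.IsHaarMeasure] (c : IrrClass ↥(unitaryGroupOfForm (conjLocal L (IsCMField.complexConj L) v) (cmLocalForm L 2 v))), c.IsSupercuspidal →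
        ∃ U : Set ↥(unitaryGroupOfForm (conjLocal L (IsCMField.complexConj L) v) (cmLocalForm L 2 v)), IsOpen U ∧ (1 : ↥(unitaryGroupOfForm (conjLocal L (IsCMField.complexConj L) v) (cmLocalForm L 2 v))) ∈ U ∧
          ∃ Θ : ↥(unitaryGroupOfForm (conjLocal L (IsCMField.complexConj L) v) (cmLocalForm L 2 v)) → ℂ, IntegrableOn Θ U μ ∧
            ∀ f : ↥(unitaryGroupOfForm (conjLocal L (IsCMField.complexConj L) v) (cmLocalForm L 2 v)) → ℂ, f ∈ SchwartzBruhat ↥(unitaryGroupOfForm (conjLocal L (IsCMField.complexConj L) v) (cmLocalForm L 2 v)) →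
              tsupport f ⊆ U → c.smoothTrace μ f = ∫ g, f g * Θ g ∂μ :=
  K2E3CharLocIntNearIdentitySupercuspidalTwoOfSCan.charLocIntNearIdentity_supercuspidal_two_of_sigSCanTwo
    sig_K2E3SupercuspidalTruncatedCharAnalyticTwo

/-! ## §R2ω (ED. 4; ED. 7: REL-TIED over PART «RankCI» (res-ω-CI) by ★ D142) — LEAF (res-ω): branch (C) of ★ D122 `K2E3U2PrincipalSeriesReducibleCut.reducible_cut_cmPrincipalSeries_two` (K2E3-p26 (g0) cand `K2/K2E3-p26/g0/subsocket_res-omega.text.txt` 8fe229f175267887 VERBATIM;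
architect K2E3-p25 (g3) bytes «=» 14:14:17Z; K2-lead (g2) R37: NO 8th printed citation — an honest OPEN XL socket).  CONSUMER: K2E3-p26 (g0) D127 `charLocIntNearIdentityResidual_of_cut (hrep) (hω)` ⇒ (qs2-res). -/

set_option maxHeartbeats 1600000 in
set_option synthInstance.maxHeartbeats 400000 in
/-- **LEAF (res-ω)** — THE ω-TYPE CORNER OF A REDUCIBLE PRINCIPAL SERIES `i_G(χ)` OF `U(Φ₂)(L⁺_v)` AT THE IDENTITY, `v` non-split: for `χ` continuous with `i_G(χ)`
REDUCIBLE and WITHOUT finite-dimensional constituents (branch (C) of ★ D122 `K2E3U2PrincipalSeriesReducibleCut.reducible_cut_cmPrincipalSeries_two`; then `i_G(χ) ⊇ π⁺` with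
quotient `π⁻`, both irreducible infinite-dimensional, JH = {π⁺, π⁻} — ★ `omega_structure_cmPrincipalSeries_two`; in `U(1,1)` language the `ω_{E∕F}`-axis `L`-packet), the
character of every constituent `c` is an integrable function near `1`.  Road: Harish-Chandra's submersion principle ∕ germ expansion at `N = 2`, or the `U(1)×U(1)`-endoscopic
character identity for the packet `{π⁺, π⁻}` (their SUM is the (qs2-ps) character).  Size: XL-adjacent (same corner as (qs2-sc)).  STATE: REL-tied (ED. 7; was OPEN) over EXACTLY {(res-ω-CI)} `sig_K2E3OmegaQuasiSplitTwoU2CharIdentity` (PART «RankCI») := ★ D142 p861578 `K2E3CharLocIntNearIdentityOmegaQuasiSplitTwoOfU2CharIdentity.omegaQuasiSplitTwo_of_u2CharIdentity` (K2E3-p21 (g8) NR-3: packet structure ★ D121∕D122 + (ASM₂-rep) ★ p861123 + `dg₂⁻¹κ ∈ L¹_loc` + ★ (LC)).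
[cite: Rogawski1990, §12.1 pp. 171–172, §12.2 p. 173] [cite: HarishChandra1999, Thm. 16.1 p. 77, §18] [cite: LabesseLanglands1979, §3] [cite: HarishChandra1970, Part VII §3 Thm. 16] -/
theorem sig_K2E3CharLocIntNearIdentityOmegaQuasiSplitTwo :
  ∀ (L : Type) [Field L] [NumberField L] [IsCMField L] (v : HeightOneSpectrum (𝓞 ↥(maximalRealSubfield L))),
      (∀ w : PlacesOver L v, IsCMField.complexConj L • w.1 = w.1) →
      ∀ [MeasurableSpace ↥(unitaryGroupOfForm (conjLocal L (IsCMField.complexConj L) v) (cmLocalForm L 2 v))] [BorelSpace ↥(unitaryGroupOfForm (conjLocal L (IsCMField.complexConj L) v) (cmLocalForm L 2 v))]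
        (μ : Measure ↥(unitaryGroupOfForm (conjLocal L (IsCMField.complexConj L) v) (cmLocalForm L 2 v))) [μ.IsHaarMeasure] (c : IrrClass ↥(unitaryGroupOfForm (conjLocal L (IsCMField.complexConj L) v) (cmLocalForm L 2 v)))
        (χ : ↥(cmBorelTriple L 2 v).M →* ℂˣ), Continuous (fun t => ((χ t : ℂˣ) : ℂ)) →
        c.IsConstituentOf (UnitaryGroup.cmPrincipalSeries L 2 v χ) → ¬ (UnitaryGroup.cmPrincipalSeries L 2 v χ).IsIrreducible →
        (∀ r : SmoothIrrep ↥(unitaryGroupOfForm (conjLocal L (IsCMField.complexConj L) v) (cmLocalForm L 2 v)), (IrrClass.mk r).IsConstituentOf (UnitaryGroup.cmPrincipalSeries L 2 v χ) → ¬ FiniteDimensional ℂ r.V) →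
        ∃ U : Set ↥(unitaryGroupOfForm (conjLocal L (IsCMField.complexConj L) v) (cmLocalForm L 2 v)), IsOpen U ∧ (1 : ↥(unitaryGroupOfForm (conjLocal L (IsCMField.complexConj L) v) (cmLocalForm L 2 v))) ∈ U ∧
          ∃ Θ : ↥(unitaryGroupOfForm (conjLocal L (IsCMField.complexConj L) v) (cmLocalForm L 2 v)) → ℂ, IntegrableOn Θ U μ ∧
            ∀ f : ↥(unitaryGroupOfForm (conjLocal L (IsCMField.complexConj L) v) (cmLocalForm L 2 v)) → ℂ, f ∈ SchwartzBruhat ↥(unitaryGroupOfForm (conjLocal L (IsCMField.complexConj L) v) (cmLocalForm L 2 v)) →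
              tsupport f ⊆ U → c.smoothTrace μ f = ∫ g, f g * Θ g ∂μ :=
  -- ED. 7 (K2E3-typ3 g0, D169): REL-TIED over EXACTLY {(res-ω-CI)} (PART «RankCI») by ★ D142 p861578 (K2E3-p21 g8), statement FROZEN
  K2E3CharLocIntNearIdentityOmegaQuasiSplitTwoOfU2CharIdentity.omegaQuasiSplitTwo_of_u2CharIdentity sig_K2E3OmegaQuasiSplitTwoU2CharIdentity

/-! ## §R2rep (ED. 5) — LEAF (ps-rep) = the (ASM₂-rep) letter: the character of the induced model `cmPrincipalSeries L 2 v χ` (`χ` continuous, `v` non-split) is an integrable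
function near EVERY `s` (architect K2E3-p25 (g3) (R2) wording = `hrep` binder of ★ p860946 VERBATIM = K2E3-p21 (g8) B2 §2 head `charLocIntNear_cmPrincipalSeries_two` token for token, architect 14:26:29Z). -/

set_option maxHeartbeats 1600000 in
set_option synthInstance.maxHeartbeats 400000 in
/-- **LEAF (ps-rep) `sig_K2E3CharLocIntNearCmPrincipalSeriesQuasiSplitTwo`** (ED. 6: **★-TIED** := ★ p861123 §2 `K2E3CharLocIntNearPrincipalSeriesQuasiSplitTwo.charLocIntNear_cmPrincipalSeries_two L v hns` by the binder adapter `fun L _ _ _ v hns => @… L _ _ _ v hns` (K2E3-p21 (g8) + squad; = the `hrep`∕`hPS` letter of ★ p860946∕p860893); statement FROZEN) — LOCAL INTEGRABILITY OF THE PRINCIPAL-SERIES CHARACTER OF `U(Φ₂)(L⁺_v)` NEAR EVERY POINT, on the induced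
model `UnitaryGroup.cmPrincipalSeries L 2 v χ` (reducible or not): `Θ_χ = (c₀∕c_T)·ϑ₂⁻¹·N_ψ`-type explicit formula via van Dijk (★ p860845 (ε₂)), Weyl integration (★ p860877), Harish-Chandra
descent on `U(1,1)` (★ p860826) and the hyperbolic class function (★ p860719) — ALL FOUR antecedents ★; payer = K2E3-p21 (g8) (ASM₂)∕(ASM₂-rep) FILE B (+ K2E3-p11 (g7) D128), the `Fin 2` twin of
★ `K2E3CharLocIntPrincipalSeriesThree`.  CONSUMERS BY NAME: (qs2-res) via ★ p860946 (this edition); (qs2-ps) via K2E3-p21 B2 §3 (`smoothTrace_eq_of_equiv` + `IrrClass.smoothTrace_mk`, to come).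
Size: M–L (assembly over ★ bricks).  STATE: ★-tied (ED. 6; was OPEN).
[cite: vanDijk1972, Thm. 1 p. 237] [cite: HarishChandra1970, Part III §5 Thm. 5 p. 32; Part VII §3] [cite: Rogawski1990, §12.1 pp. 171–172] -/
theorem sig_K2E3CharLocIntNearCmPrincipalSeriesQuasiSplitTwo :
 ∀ (L : Type) [Field L] [NumberField L] [IsCMField L] (v : HeightOneSpectrum (𝓞 ↥(maximalRealSubfield L))),
      (∀ w : PlacesOver L v, IsCMField.complexConj L • w.1 = w.1) →
      ∀ [MeasurableSpace ↥(unitaryGroupOfForm (conjLocal L (IsCMField.complexConj L) v) (cmLocalForm L 2 v))] [BorelSpace ↥(unitaryGroupOfForm (conjLocal L (IsCMField.complexConj L) v) (cmLocalForm L 2 v))]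
        (μ : Measure ↥(unitaryGroupOfForm (conjLocal L (IsCMField.complexConj L) v) (cmLocalForm L 2 v))) [μ.IsHaarMeasure]
        (χ : ↥(cmBorelTriple L 2 v).M →* ℂˣ), Continuous (fun t => ((χ t : ℂˣ) : ℂ)) →
      ∀ s : ↥(unitaryGroupOfForm (conjLocal L (IsCMField.complexConj L) v) (cmLocalForm L 2 v)),
        ∃ U : Set ↥(unitaryGroupOfForm (conjLocal L (IsCMField.complexConj L) v) (cmLocalForm L 2 v)), IsOpen U ∧ s ∈ U ∧
          ∃ Θ : ↥(unitaryGroupOfForm (conjLocal L (IsCMField.complexConj L) v) (cmLocalForm L 2 v)) → ℂ, IntegrableOn Θ U μ ∧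
            ∀ f : ↥(unitaryGroupOfForm (conjLocal L (IsCMField.complexConj L) v) (cmLocalForm L 2 v)) → ℂ, f ∈ SchwartzBruhat ↥(unitaryGroupOfForm (conjLocal L (IsCMField.complexConj L) v) (cmLocalForm L 2 v)) →
              tsupport f ⊆ U → Representation.smoothTrace (G := ↥(unitaryGroupOfForm (conjLocal L (IsCMField.complexConj L) v) (cmLocalForm L 2 v))) (UnitaryGroup.cmPrincipalSeries L 2 v χ) μ f = ∫ g, f g * Θ g ∂μ :=
  fun L _ _ _ v hns => @K2E3CharLocIntNearPrincipalSeriesQuasiSplitTwo.charLocIntNear_cmPrincipalSeries_two L _ _ _ v hns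

set_option maxHeartbeats 1600000 in
set_option synthInstance.maxHeartbeats 400000 in
/-- **LEAF (qs2-res)** (ED. 5: **★-TIED BY NAME** := ★ p860946 `K2E3CharLocIntNearIdentityResidualQuasiSplitTwoOfCut.charLocIntNearIdentityResidual_of_cut (ps-rep) (res-ω)` — K2E3-p26 (g0) D127 over ★ D121∕D122∕D123∕p855012; REL over EXACTLY {(ps-rep), (res-ω)}; statement FROZEN; ED. 2–4: OPEN) — THE CONSTITUENTS OF A REDUCIBLE PRINCIPAL SERIES `i_G(χ)` OF `U(Φ₂)(L⁺_v)` AT THE IDENTITY, `v` non-split: for `χ` continuous with `i_G(χ)` REDUCIBLE and `c` a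
constituent, `χ_c` is an integrable function near `1` (for `U(1,1)`: `χ|_{F^×}·` modulus-type points ⇒ 1-dim ⊕ Steinberg-type constituents — ★ p858540 `charLocIntNear_trivial_twist` ∕
`charLocIntNear_add∕_smul` against (qs2-ps); the `ω_{E∕F}`-axis points ⇒ two tempered pieces — a length-2∕multiplicity-one structure (twins of ★ S1b∕S1c p860175∕p860295) and one
piece by another road).  Size: L (XL-adjacent corner: the `ω`-axis pair).  STATE: OPEN.
[cite: Rogawski1990, §12.1 pp. 171–172, §12.2 p. 173] [cite: HarishChandra1999, Thm. 16.1 p. 77] [cite: BernsteinZelevinsky1977, §2.5] -/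
theorem sig_K2E3CharLocIntNearIdentityResidualQuasiSplitTwo :
  ∀ (L : Type) [Field L] [NumberField L] [IsCMField L] (v : HeightOneSpectrum (𝓞 ↥(maximalRealSubfield L))),
      (∀ w : PlacesOver L v, IsCMField.complexConj L • w.1 = w.1) →
      ∀ [MeasurableSpace ↥(unitaryGroupOfForm (conjLocal L (IsCMField.complexConj L) v) (cmLocalForm L 2 v))] [BorelSpace ↥(unitaryGroupOfForm (conjLocal L (IsCMField.complexConj L) v) (cmLocalForm L 2 v))]
        (μ : Measure ↥(unitaryGroupOfForm (conjLocal L (IsCMField.complexConj L) v) (cmLocalForm L 2 v))) [μ.IsHaarMeasure] (c : IrrClass ↥(unitaryGroupOfForm (conjLocal L (IsCMField.complexConj L) v) (cmLocalForm L 2 v)))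
        (χ : ↥(cmBorelTriple L 2 v).M →* ℂˣ), Continuous (fun t => ((χ t : ℂˣ) : ℂ)) →
        c.IsConstituentOf (UnitaryGroup.cmPrincipalSeries L 2 v χ) → ¬ (UnitaryGroup.cmPrincipalSeries L 2 v χ).IsIrreducible →
        ∃ U : Set ↥(unitaryGroupOfForm (conjLocal L (IsCMField.complexConj L) v) (cmLocalForm L 2 v)), IsOpen U ∧ (1 : ↥(unitaryGroupOfForm (conjLocal L (IsCMField.complexConj L) v) (cmLocalForm L 2 v))) ∈ U ∧
          ∃ Θ : ↥(unitaryGroupOfForm (conjLocal L (IsCMField.complexConj L) v) (cmLocalForm L 2 v)) → ℂ, IntegrableOn Θ U μ ∧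
            ∀ f : ↥(unitaryGroupOfForm (conjLocal L (IsCMField.complexConj L) v) (cmLocalForm L 2 v)) → ℂ, f ∈ SchwartzBruhat ↥(unitaryGroupOfForm (conjLocal L (IsCMField.complexConj L) v) (cmLocalForm L 2 v)) →
              tsupport f ⊆ U → c.smoothTrace μ f = ∫ g, f g * Θ g ∂μ :=
  K2E3CharLocIntNearIdentityResidualQuasiSplitTwoOfCut.charLocIntNearIdentityResidual_of_cut
    sig_K2E3CharLocIntNearCmPrincipalSeriesQuasiSplitTwo sig_K2E3CharLocIntNearIdentityOmegaQuasiSplitTwo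

/-! ## §R2ns (ED. 1) — (11-2qs-Id′): the quasi-split rank-2 unitary group near the identity, on the organ carrier (K2E3-p27 (g0) census D111, cand v2) -/

set_option maxHeartbeats 1600000 in
set_option synthInstance.maxHeartbeats 400000 in
/-- **(11-2qs-Id′) `sig_K2E3CharLocIntNearIdentityQuasiSplitTwo`** (socket; ED. 2: **REL-TIED BY CLASS** over EXACTLY {(qs2-ps), (qs2-sc), (qs2-res)} — body = K2E3-p27 (g0) cand `tie_qs2Id` proof VERBATIM over ★ p860637 (qs2-cls); ED. 1: OPEN; statement = K2E3-p27 (g0) `subsocket_11-2qs-Id-prime.text.txt` b07cb765566c4669 VERBATIM, FROZEN from PART «RANK» ED. 1).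
For every CM field `L` and finite place `v` of `L⁺` with every place `w ∣ v` fixed by complex conjugation (`v` NON-SPLIT; vacuous at split `v` by intent), every Borel structure and Haar
measure `μ` on the quasi-split semi-local carrier `U(Φ₂)(L⁺_v) = ↥(unitaryGroupOfForm (conjLocal L (IsCMField.complexConj L) v) (cmLocalForm L 2 v))` (≅ U(1,1)(L⁺_v); the home of
★ `cmPrincipalSeries L 2 v` ∕ ★ `cmBorelTriple L 2 v` ∕ ★ HC₂) and every irreducible smooth class `c` (admissible by ★ p857017): there is an open `U ∋ 1` and `Θ ∈ L¹(U, μ)` with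
`χ_c(f) = ∫ f·Θ dμ` for every Schwartz–Bruhat `f` supported in `U` — Harish-Chandra's local integrability of irreducible characters, near `1`, for the p-adic U(1,1).  Consumed BY NAME as
the antecedent `hqs₂` of ★ p860510 `K2E3CharLocIntNearSemisimpleNonsplitTwoOfQuasiSplitIdentity.charLocIntNearSemisimple_nonsplitTwo_of_cmQsIdentity` (MAIN (11-2-nonsplit) tie, ED. 35);
K2E3-p21 (g7)'s (qs2-ps) head (every `s`, same carrier) docks here at `s = 1` with no transport.  Why it might fail as typed: it should not — `char = 0` and the statement is (weaker than)
the standard theorem `Θ_π ∈ L¹_loc(G)`; the risk is only SIZE (germ expansion ∕ submersion road at N = 2 in our currency; the N = 2 supercuspidal corner is honest XL-adjacent).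
[cite: HarishChandra1999, Thm. 16.1 p. 77, §18 pp. 78–80] [cite: HarishChandra1970, Part VII §3 Thm. 16 p. 67] [cite: Rogawski1990, §12.1 p. 171] -/
theorem sig_K2E3CharLocIntNearIdentityQuasiSplitTwo :
    ∀ (L : Type) [Field L] [NumberField L] [IsCMField L] (v : HeightOneSpectrum (𝓞 ↥(maximalRealSubfield L))),
      (∀ w : PlacesOver L v, IsCMField.complexConj L • w.1 = w.1) →
      ∀ [MeasurableSpace ↥(unitaryGroupOfForm (conjLocal L (IsCMField.complexConj L) v) (cmLocalForm L 2 v))] [BorelSpace ↥(unitaryGroupOfForm (conjLocal L (IsCMField.complexConj L) v) (cmLocalForm L 2 v))]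
        (μ : Measure ↥(unitaryGroupOfForm (conjLocal L (IsCMField.complexConj L) v) (cmLocalForm L 2 v))) [μ.IsHaarMeasure] (c : IrrClass ↥(unitaryGroupOfForm (conjLocal L (IsCMField.complexConj L) v) (cmLocalForm L 2 v))),
        ∃ U : Set ↥(unitaryGroupOfForm (conjLocal L (IsCMField.complexConj L) v) (cmLocalForm L 2 v)), IsOpen U ∧ (1 : ↥(unitaryGroupOfForm (conjLocal L (IsCMField.complexConj L) v) (cmLocalForm L 2 v))) ∈ U ∧
          ∃ Θ : ↥(unitaryGroupOfForm (conjLocal L (IsCMField.complexConj L) v) (cmLocalForm L 2 v)) → ℂ, IntegrableOn Θ U μ ∧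
            ∀ f : ↥(unitaryGroupOfForm (conjLocal L (IsCMField.complexConj L) v) (cmLocalForm L 2 v)) → ℂ, f ∈ SchwartzBruhat ↥(unitaryGroupOfForm (conjLocal L (IsCMField.complexConj L) v) (cmLocalForm L 2 v)) →
              tsupport f ⊆ U → c.smoothTrace μ f = ∫ g, f g * Θ g ∂μ := by
  intro L _ _ _ v hns _ _ μ _ c
  have hD := K2E3LocalIrrepCuspidalOrPrincipalTwo.irrClass_isSupercuspidal_or_isConstituentOf_cmPrincipalSeries_two L v hns c
  rcases hD with hsc | ⟨χ, hχ, hconst⟩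
  · exact sig_K2E3CharLocIntNearIdentitySupercuspidalQuasiSplitTwo L v hns μ c hsc
  · by_cases hirr : (UnitaryGroup.cmPrincipalSeries L 2 v χ).IsIrreducible
    · have heq := (IrrClass.isConstituentOf_iff_eq_mk _ hirr (K2E3LocalIrrepCuspidalOrPrincipalTwo.isSmooth_cmPrincipalSeries L 2 v χ) c).1 hconst
      subst heq
      exact sig_K2E3CharLocIntNearPrincipalSeriesQuasiSplitTwo L v hns μ χ hχ _ _ rfl ⟨Representation.Equiv.refl _⟩ 1
    · exact sig_K2E3CharLocIntNearIdentityResidualQuasiSplitTwo L v hns μ c χ hχ hconst hirr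

end Summit.HodgeConjecture.HodgeConjecture.Cruxes.H413.K2E3EllipticInputs.U12Characters

end
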